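import Literature.MathematicalPhysics.QuantumFieldTheory.Balaban1983to89.Beta.AveragingWardJets
import Literature.MathematicalPhysics.QuantumFieldTheory.Balaban1983to89.Beta.RootedKernelReflection

/-!
# `BalabanUV.Beta.AveragingWardRooted` — node 8 (`Beta.AveragingWardJets`) RE-RUN WITH THE GENERIC ROOT OFFSET `ρ` of
# node 5ρ/7aρ, letter flavour: the rooted path Ward lemmas, the rooted generic second-order functionals `skewHessAt β ρ`,
# `skewVHAt β ρ`, and THE FOUR EXACT ROOTED SECOND-ORDER WARD IDENTITIES (leaf 1 of 3 of node 8ρ), v1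

HONEST FRAMING (page 1, mandatory).  This leaf belongs to the β sub-cell of the Bałaban audit, whose END STATEMENT is:
discharging the one-loop hypothesis `FlowStep.BetaPertH` makes Bałaban's ultraviolet stability theorem for 4-d lattice
Yang–Mills ([Balaban1989LargeFieldII], Thm. 1 p. 355) UNCONDITIONAL inside this package — a real constructive-QFT result;
it is NOT the continuum limit and NOT the Clay problem.  EVERYTHING below is kernel-proved [folklore] algebra of finite
letter lists and finite sums on `ℤ^d`; NOTHING is cited as a fact; B7 (11) («Ū^u = (Ū)^u», the gauge covariance of the
averaging) is NOT asserted, at any order.  HONEST DEPENDENCY (cell records, verbatim): «continuum YM on T⁴ ⇐ BetaPertH ∧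
nine spine estimates (0/9 proved); BetaPertH ⇐ (D1) ∧ (D4) ∧ CAP+tail; G-an2-4 gates asym, D1 and NE2/3/4.»  This leaf
is a DATUM for row D1's gauge binder (the (W1)/(W2)-type input of `Beta.KernelWard.ward_hess` for the vh-piece of the
rooted one-step spine); it is NOT `BetaPertH`.

ABSOLUTE RULE (cell charter, verbatim): «No internally-minted statement may enter as a cited fact. Every hypothesis is
either kernel-proved in this package or a verbatim quotation of a PUBLISHED theorem with page reference. The manuscript(s)
under audit are NOT citable for their own disputed steps — they are the thing under adjudication; programme-internal
(2001/route/tribunal) claims are never citable.»  Accordingly NO declaration below is a `def … : Prop` carrying a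
citation and no hypothesis of any theorem is a printed statement: every declaration is [folklore].

WHY THESE LEAVES (node 8ρ = `AveragingWardRooted` + `AveragingWardRootedKernels` + `AveragingWardRootedStencils`).
β-lead RULING (R26) P6c / (R28-2) name the an1-owed datum «averaging jets: background-gauge covariance at SECOND order»;
node 8 (`Beta.AveragingWardJets`) / node 8b (`Beta.AveragingWardStencils`) delivered it for the BASE-CORNER root `L·y`
of node 5.  RULING (R32) re-rooted the road's literal family at a generic offset (`ρ = ctr`, odd `L`, the centred system
of [Balaban1987RG1] p.251): node 5ρ (`Beta.AveragingContoursRooted`), node 7aρ (`Beta.AveragingHessianKernelsRooted`),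
and an2's ROOTED spine `SpineRootedS0N.S0NAt ρ cE cVH cΛ := cE • wilsonA + cVH • vhSAt ρ d Lc + cΛ • SLam …` (native
placement) now consume `vhSAt ρ`, NOT `vhS`.  Node 8ρ is the rooted twin of node 8 + node 8b: every theorem re-proved
ρ-generically by node 8's own scripts with the root `L·y` replaced by `r(y) = L·y + ρ`, the `ρ = 0` instances identified
with node 8 / node 8b BY NAME; split in three leaves by the tree's size lint (letters here; the kernel laws (K-H)ρ, (K-V1)ρ
in `…Kernels`; the consumed law (K-V2)ρ and the stencil law (S-V)ρ in both placements in `…Stencils`).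

WHAT IS TYPED HERE (`r = L·y + ρ` the root, `c = ⟨r, r + L·e_μ⟩` the straight coarse bond from the root, `Z = linAvgAt ρ`):
* §1 the rooted PATH WARD LEMMAS `skew_gammaCAt_grad`, `skew_loopCAt_grad` (endpoints `r`, `r + L·e_μ`; closed loop: `β (λ r + λ r)`);
* §2 the generic rooted functionals `skewHessAt β ρ X X′` / `skewVHAt β ρ X X′`, additivity in both slots, exchange, sums;
* §3 THE FOUR EXACT SECOND-ORDER WARD IDENTITIES, rooted: `skewHessAt_grad_left/right` (conjugation at `r` AND
  `r + L·e_μ`), `skewVHAt_grad_left` (only `r + L·e_μ` survives), `skewVHAt_grad_right` (only the ROOT `r` survives);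
* §4 bridges `skewHessAt β 0 = skewHess β`, `skewVHAt β 0 = skewVH β` (node 8); `hessCountAt ρ`/`vhCountAt ρ = skew…At (·*·) ρ δ δ`.
The divergence laws built on these are in the sibling leaves `AveragingWardRootedKernels` ((K-H)ρ, (K-V1)ρ, real forms)
and `AveragingWardRootedStencils` ((K-V2)ρ — the contact MOVES WITH THE ROOT — and the stencil law (S-V)ρ for `vhSAt ρ`).

WHAT IS NOT PROVED / NOT CLAIMED: nothing printed (B7 (11) in particular is NOT asserted); nothing about `Φ_b` /
logarithms (node 7b); nothing about `wilsonA` / `SLam`, `KInv`, `vertexOf`, (W1′)/(W2′), the socket (Sr-conj), (R45),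
P6c as a hypothesis, (R1), (K1·), `BetaPertH`.

Provenance: cell pub-balaban, β sub-cell, lineage an1, gen 23 (2026-08-20), node 8ρ of the an1 plan; over node 8 (an1 gen 12),
node 5ρ / 7aρ (an1 gen 13/14) and an5's `RootedKernelReflection` (two letter projections, BY NAME); no existing file
touched.  Bib keys (locators only): Balaban1985Averaging, Balaban1987RG1, Balaban1989LargeFieldII.
-/

open Finset
open Literature.MathematicalPhysics.QuantumFieldTheory.Balaban1983to89
open Literature.MathematicalPhysics.QuantumFieldTheory.Balaban1983to89.Beta
open AffineAveraging AveragingContours TransportedContourVariables AveragingHessianKernels AveragingWardJets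
  AveragingContoursRooted AveragingHessianKernelsRooted

namespace Summit.QuantumFields.BalabanUV.Beta.AveragingWardRooted

/-! ## §1 The rooted path Ward lemmas -/

section PathWard

variable {d : ℕ} {A V : Type*} [AddCommGroup A] [AddCommGroup V] (β : A →+ A →+ V)

/-- [folklore] **PATH WARD LEMMA along the rooted contour `Γ^ρ_{c,x}`** (from the root `r = L·y + ρ` to `r + L·e_μ`):
`skew β (grad λ, B) = Σ midF − β (λ(r) + λ(r + L·e_μ)) (Σ B)`. -/
theorem skew_gammaCAt_grad (ρ : Fin d → ℤ) (lam : (Fin d → ℤ) → A) (B : Form1 d A) (L : ℕ) (μ : Fin d)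
    (y : Fin d → ℤ) (b : Fin d → ℕ) :
    skew β (gammaCAt ρ (pairForm (grad lam) B) L μ y b)
      = (gammaCAt ρ (midF β lam B) L μ y b).sum
        - β (lam ((L : ℤ) • y + ρ) + lam ((L : ℤ) • y + ρ + (L : ℤ) • unitVec μ)) (gammaCAt ρ B L μ y b).sum := by
  simp only [gammaCAt, skew_append, skew_rev, skew_axial_grad, skew_segUp_grad, bg_append, fl_append, bg_rev, fl_rev,
    rev_sum, List.sum_append, bg_axial_pairForm, fl_axial_pairForm, bg_segUp_pairForm, fl_segUp_pairForm,
    axial_sum_grad, segUp_sum_grad, map_add, map_sub, map_neg, AddMonoidHom.add_apply, AddMonoidHom.sub_apply,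
    AddMonoidHom.neg_apply]
  abel

/-- [folklore] **PATH WARD LEMMA along the rooted closed loop `Γ^ρ_{c,x} ∪ (−c)`** (from `r` back to `r`): the
coefficient of `Σ B` is `β` of TWICE the gauge function at the ROOT. -/
theorem skew_loopCAt_grad (ρ : Fin d → ℤ) (lam : (Fin d → ℤ) → A) (B : Form1 d A) (L : ℕ) (μ : Fin d)
    (y : Fin d → ℤ) (b : Fin d → ℕ) :
    skew β (loopCAt ρ (pairForm (grad lam) B) L μ y b)
      = (loopCAt ρ (midF β lam B) L μ y b).sum
        - β (lam ((L : ℤ) • y + ρ) + lam ((L : ℤ) • y + ρ)) (loopCAt ρ B L μ y b).sum := by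
  simp only [loopCAt, skew_append, skew_rev, skew_gammaCAt_grad, skew_segUp_grad, bg_rev, fl_rev, rev_sum,
    List.sum_append, RootedKernelReflection.bg_gammaCAt_pairForm, RootedKernelReflection.fl_gammaCAt_pairForm,
    bg_segUp_pairForm, fl_segUp_pairForm, gammaCAt_sum_grad, segUp_sum_grad, map_add, map_sub, map_neg, AddMonoidHom.add_apply, AddMonoidHom.sub_apply,
    AddMonoidHom.neg_apply]
  abel

end PathWard

/-! ## §2 The rooted generic second-order functionals `skewHessAt β ρ`, `skewVHAt β ρ` -/

section Functional

variable {d : ℕ} {A V : Type*} [AddCommGroup A] [AddCommGroup V] (β : A →+ A →+ V)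

/-- [folklore] THE ROOTED GENERIC SECOND-ORDER FUNCTIONAL of a biadditive pairing `β`: node 8's `skewHess β` over the
rooted loops `loopCAt ρ`, the rooted averaging `Z = linAvgAt ρ` and the straight coarse bond FROM THE ROOT
`[L·y + ρ, L·y + ρ + L·e_μ]` (node 7aρ's `hessUAt ρ` is the instance `β = [·,·]`, its `hessCountAt ρ` the instance
`β = (·*·)` on `ℤ` at indicator forms, `hessCountAt_eq_skewHessAt`). -/
def skewHessAt (ρ : Fin d → ℤ) (X X' : Form1 d A) (L : ℕ) (μ : Fin d) (y : Fin d → ℤ) : V :=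
  (∑ b ∈ box d L, skew β (loopCAt ρ (pairForm X X') L μ y b))
    + (β (linAvgAt ρ X L μ y) (segUp X' ((L : ℤ) • y + ρ) μ L).sum
        - β (segUp X ((L : ℤ) • y + ρ) μ L).sum (linAvgAt ρ X' L μ y))
    + ((L : ℤ) ^ d) • skew β (segUp (pairForm X X') ((L : ℤ) • y + ρ) μ L)

/-- [folklore] THE ROOTED GENERIC PRODUCT-CHART FUNCTIONAL (node 7aρ's `vhUAt ρ` / `vhCountAt ρ` are the instances
`β = [·,·]` / `β = (·*·)`, `vhCountAt_eq_skewVHAt`): `L^d • skewHessAt + L^d • Z (ptF β X X′) − β (Z X) (Z X′)`. -/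
def skewVHAt (ρ : Fin d → ℤ) (X X' : Form1 d A) (L : ℕ) (μ : Fin d) (y : Fin d → ℤ) : V :=
  ((L : ℤ) ^ d) • skewHessAt β ρ X X' L μ y + ((L : ℤ) ^ d) • linAvgAt ρ (ptF β X X') L μ y
    - β (linAvgAt ρ X L μ y) (linAvgAt ρ X' L μ y)

/-- [folklore] `linAvgAt ρ 0 = 0`. -/
theorem linAvgAt_zeroForm (ρ : Fin d → ℤ) (L : ℕ) (μ : Fin d) (y : Fin d → ℤ) :
    linAvgAt ρ (0 : Form1 d A) L μ y = 0 := by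
  simpa using linAvgAt_sub ρ (0 : Form1 d A) 0 L μ y

/-- [folklore] `linAvgAt ρ` is additive in the form (sums; node 5ρ `linAvgAt_sub`). -/
theorem linAvgAt_addForm (ρ : Fin d → ℤ) (X X' : Form1 d A) (L : ℕ) (μ : Fin d) (y : Fin d → ℤ) :
    linAvgAt ρ (X + X') L μ y = linAvgAt ρ X L μ y + linAvgAt ρ X' L μ y := by
  have h := linAvgAt_sub ρ (X + X') X' L μ y
  rw [add_sub_cancel_right] at h
  rw [h]; abel

/-- [folklore] `Σ_{x ∈ B(y)} X(loop^ρ_x) = Z X − L^d • X(c)` with the coarse bond from the root. -/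
theorem sum_box_loopCAt_sum (ρ : Fin d → ℤ) (X : Form1 d A) (L : ℕ) (μ : Fin d) (y : Fin d → ℤ) :
    ∑ b ∈ box d L, (loopCAt ρ X L μ y b).sum
      = linAvgAt ρ X L μ y - ((L : ℤ) ^ d) • (segUp X ((L : ℤ) • y + ρ) μ L).sum := by
  have hcard : (box d L).card = L ^ d := by simp [AffineAveraging.box, Fintype.card_piFinset]
  simp only [loopCAt, List.sum_append, rev_sum, Finset.sum_add_distrib, Finset.sum_neg_distrib, Finset.sum_const,
    hcard, linAvgAt, ← natCast_zsmul, Nat.cast_pow]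
  abel

/-- [folklore] ADDITIVITY of the rooted loop `skew` in the first form. -/
theorem skew_loopCAt_add_left (ρ : Fin d → ℤ) (X₁ X₂ X' : Form1 d A) (L : ℕ) (μ : Fin d) (y : Fin d → ℤ)
    (b : Fin d → ℕ) :
    skew β (loopCAt ρ (pairForm (X₁ + X₂) X') L μ y b)
      = skew β (loopCAt ρ (pairForm X₁ X') L μ y b) + skew β (loopCAt ρ (pairForm X₂ X') L μ y b) := by
  have e : ∀ w : A × A →+ A, pairForm (fun κ x => w (X₁ κ x, X₂ κ x)) X'
      = mapForm (w.prodMap (AddMonoidHom.fst A A)) (pairForm (pairForm X₁ X₂) (pairForm X' X')) := by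
    intro w; funext κ x; simp
  have c : ∀ w : A × A →+ A,
      (loopCAt ρ (pairForm (pairForm X₁ X₂) (pairForm X' X')) L μ y b).map ⇑(w.prodMap (AddMonoidHom.fst A A))
        = (loopCAt ρ (pairForm (pairForm X₁ X₂) (pairForm X' X')) L μ y b).map fun t => (w t.1, t.2.1) := by
    intro w; apply List.map_congr_left; intro t _; rfl
  have h₀ : pairForm (X₁ + X₂) X'
      = pairForm (fun κ x => (AddMonoidHom.fst A A + AddMonoidHom.snd A A) (X₁ κ x, X₂ κ x)) X' := by
    funext κ x; simp
  have h₁ : pairForm X₁ X' = pairForm (fun κ x => (AddMonoidHom.fst A A) (X₁ κ x, X₂ κ x)) X' := by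
    funext κ x; simp
  have h₂ : pairForm X₂ X' = pairForm (fun κ x => (AddMonoidHom.snd A A) (X₁ κ x, X₂ κ x)) X' := by
    funext κ x; simp
  rw [h₀, h₁, h₂, e, e, e, ← loopCAt_map, ← loopCAt_map, ← loopCAt_map, c, c, c]
  simpa using skew_map_add_fst β (fun q : A × A => q.1) (fun q : A × A => q.2) (fun q : A × A => q.1)
    (loopCAt ρ (pairForm (pairForm X₁ X₂) (pairForm X' X')) L μ y b)

/-- [folklore] `skewHessAt β ρ` is ADDITIVE in the first form. -/
theorem skewHessAt_add_left (ρ : Fin d → ℤ) (X₁ X₂ X' : Form1 d A) (L : ℕ) (μ : Fin d) (y : Fin d → ℤ) :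
    skewHessAt β ρ (X₁ + X₂) X' L μ y = skewHessAt β ρ X₁ X' L μ y + skewHessAt β ρ X₂ X' L μ y := by
  simp only [skewHessAt, skew_loopCAt_add_left, skew_segUp_add_left, Finset.sum_add_distrib, linAvgAt_addForm,
    segUp_sum_addForm, map_add, AddMonoidHom.add_apply, smul_add]
  abel

/-- [folklore] `skewHessAt β ρ 0 X′ = 0`. -/
theorem skewHessAt_zero_left (ρ : Fin d → ℤ) (X' : Form1 d A) (L : ℕ) (μ : Fin d) (y : Fin d → ℤ) :
    skewHessAt β ρ 0 X' L μ y = 0 := by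
  have h := skewHessAt_add_left β ρ 0 0 X' L μ y
  rw [add_zero] at h
  exact left_eq_add.mp h

/-- [folklore] `skewHessAt β ρ` respects differences in the first form. -/
theorem skewHessAt_sub_left (ρ : Fin d → ℤ) (X₁ X₂ X' : Form1 d A) (L : ℕ) (μ : Fin d) (y : Fin d → ℤ) :
    skewHessAt β ρ (X₁ - X₂) X' L μ y = skewHessAt β ρ X₁ X' L μ y - skewHessAt β ρ X₂ X' L μ y := by
  have h := skewHessAt_add_left β ρ (X₁ - X₂) X₂ X' L μ y
  rw [sub_add_cancel] at h
  rw [h]; abel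

/-- [folklore] `skewHessAt β ρ` respects finite sums in the first form. -/
theorem skewHessAt_sum_left {ι : Type*} (s : Finset ι) (ρ : Fin d → ℤ) (X : ι → Form1 d A) (X' : Form1 d A) (L : ℕ)
    (μ : Fin d) (y : Fin d → ℤ) :
    skewHessAt β ρ (∑ i ∈ s, X i) X' L μ y = ∑ i ∈ s, skewHessAt β ρ (X i) X' L μ y := by
  classical
  refine Finset.induction_on s ?_ ?_
  · simp [skewHessAt_zero_left]
  · intro i s hi ih
    rw [Finset.sum_insert hi, Finset.sum_insert hi, skewHessAt_add_left, ih]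

/-- [folklore] SLOT EXCHANGE: `skewHessAt β ρ X′ X = − skewHessAt β.flip ρ X X′`. -/
theorem skewHessAt_swap (ρ : Fin d → ℤ) (X X' : Form1 d A) (L : ℕ) (μ : Fin d) (y : Fin d → ℤ) :
    skewHessAt β ρ X' X L μ y = -skewHessAt β.flip ρ X X' L μ y := by
  have hp : pairForm X' X = mapForm (AddEquiv.prodComm : A × A ≃+ A × A).toAddMonoidHom (pairForm X X') := by
    funext κ x; rfl
  have hl : ∀ b, loopCAt ρ (pairForm X' X) L μ y b = (loopCAt ρ (pairForm X X') L μ y b).map Prod.swap := by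
    intro b; rw [hp, ← loopCAt_map]; rfl
  have hs : segUp (pairForm X' X) ((L : ℤ) • y + ρ) μ L = (segUp (pairForm X X') ((L : ℤ) • y + ρ) μ L).map Prod.swap := by
    rw [hp, ← segUp_map]; rfl
  simp only [skewHessAt, hl, hs, skew_swap, Finset.sum_neg_distrib, AddMonoidHom.flip_apply, smul_neg]
  abel

/-- [folklore] `skewHessAt β ρ` is ADDITIVE in the second form. -/
theorem skewHessAt_add_right (ρ : Fin d → ℤ) (X X'₁ X'₂ : Form1 d A) (L : ℕ) (μ : Fin d) (y : Fin d → ℤ) :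
    skewHessAt β ρ X (X'₁ + X'₂) L μ y = skewHessAt β ρ X X'₁ L μ y + skewHessAt β ρ X X'₂ L μ y := by
  rw [skewHessAt_swap β ρ (X'₁ + X'₂) X, skewHessAt_swap β ρ X'₁ X, skewHessAt_swap β ρ X'₂ X, skewHessAt_add_left,
    neg_add]

/-- [folklore] `skewHessAt β ρ` respects differences in the second form. -/
theorem skewHessAt_sub_right (ρ : Fin d → ℤ) (X X'₁ X'₂ : Form1 d A) (L : ℕ) (μ : Fin d) (y : Fin d → ℤ) :
    skewHessAt β ρ X (X'₁ - X'₂) L μ y = skewHessAt β ρ X X'₁ L μ y - skewHessAt β ρ X X'₂ L μ y := by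
  rw [skewHessAt_swap β ρ (X'₁ - X'₂) X, skewHessAt_swap β ρ X'₁ X, skewHessAt_swap β ρ X'₂ X, skewHessAt_sub_left]
  abel

/-- [folklore] `skewHessAt β ρ` respects finite sums in the second form. -/
theorem skewHessAt_sum_right {ι : Type*} (s : Finset ι) (ρ : Fin d → ℤ) (X : Form1 d A) (X' : ι → Form1 d A) (L : ℕ)
    (μ : Fin d) (y : Fin d → ℤ) :
    skewHessAt β ρ X (∑ i ∈ s, X' i) L μ y = ∑ i ∈ s, skewHessAt β ρ X (X' i) L μ y := by
  rw [skewHessAt_swap β ρ _ X, skewHessAt_sum_left, ← Finset.sum_neg_distrib]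
  refine Finset.sum_congr rfl fun i _ => ?_
  rw [skewHessAt_swap β ρ (X' i) X]

/-- [folklore] `skewVHAt β ρ` is ADDITIVE in the first form. -/
theorem skewVHAt_add_left (ρ : Fin d → ℤ) (X₁ X₂ X' : Form1 d A) (L : ℕ) (μ : Fin d) (y : Fin d → ℤ) :
    skewVHAt β ρ (X₁ + X₂) X' L μ y = skewVHAt β ρ X₁ X' L μ y + skewVHAt β ρ X₂ X' L μ y := by
  have hpt : ptF β (X₁ + X₂) X' = ptF β X₁ X' + ptF β X₂ X' := by
    funext κ x; simp [map_add, AddMonoidHom.add_apply]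
  simp only [skewVHAt, skewHessAt_add_left, hpt, linAvgAt_addForm, map_add, AddMonoidHom.add_apply, smul_add]
  abel

/-- [folklore] `skewVHAt β ρ` respects differences in the first form. -/
theorem skewVHAt_sub_left (ρ : Fin d → ℤ) (X₁ X₂ X' : Form1 d A) (L : ℕ) (μ : Fin d) (y : Fin d → ℤ) :
    skewVHAt β ρ (X₁ - X₂) X' L μ y = skewVHAt β ρ X₁ X' L μ y - skewVHAt β ρ X₂ X' L μ y := by
  have h := skewVHAt_add_left β ρ (X₁ - X₂) X₂ X' L μ y
  rw [sub_add_cancel] at h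
  rw [h]; abel

/-- [folklore] `skewVHAt β ρ 0 X′ = 0`. -/
theorem skewVHAt_zero_left (ρ : Fin d → ℤ) (X' : Form1 d A) (L : ℕ) (μ : Fin d) (y : Fin d → ℤ) :
    skewVHAt β ρ 0 X' L μ y = 0 := by
  have h := skewVHAt_add_left β ρ 0 0 X' L μ y
  rw [add_zero] at h
  exact left_eq_add.mp h

/-- [folklore] `skewVHAt β ρ` respects finite sums in the first form. -/
theorem skewVHAt_sum_left {ι : Type*} (s : Finset ι) (ρ : Fin d → ℤ) (X : ι → Form1 d A) (X' : Form1 d A) (L : ℕ)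
    (μ : Fin d) (y : Fin d → ℤ) :
    skewVHAt β ρ (∑ i ∈ s, X i) X' L μ y = ∑ i ∈ s, skewVHAt β ρ (X i) X' L μ y := by
  classical
  refine Finset.induction_on s ?_ ?_
  · simp [skewVHAt_zero_left]
  · intro i s hi ih
    rw [Finset.sum_insert hi, Finset.sum_insert hi, skewVHAt_add_left, ih]

/-- [folklore] `skewVHAt β ρ` is ADDITIVE in the second form. -/
theorem skewVHAt_add_right (ρ : Fin d → ℤ) (X X'₁ X'₂ : Form1 d A) (L : ℕ) (μ : Fin d) (y : Fin d → ℤ) :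
    skewVHAt β ρ X (X'₁ + X'₂) L μ y = skewVHAt β ρ X X'₁ L μ y + skewVHAt β ρ X X'₂ L μ y := by
  have hpt : ptF β X (X'₁ + X'₂) = ptF β X X'₁ + ptF β X X'₂ := by
    funext κ x; simp [map_add]
  simp only [skewVHAt, skewHessAt_add_right, hpt, linAvgAt_addForm, map_add, smul_add]
  abel

/-- [folklore] `skewVHAt β ρ` respects differences in the second form. -/
theorem skewVHAt_sub_right (ρ : Fin d → ℤ) (X X'₁ X'₂ : Form1 d A) (L : ℕ) (μ : Fin d) (y : Fin d → ℤ) :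
    skewVHAt β ρ X (X'₁ - X'₂) L μ y = skewVHAt β ρ X X'₁ L μ y - skewVHAt β ρ X X'₂ L μ y := by
  have h := skewVHAt_add_right β ρ X (X'₁ - X'₂) X'₂ L μ y
  rw [sub_add_cancel] at h
  rw [h]; abel

/-- [folklore] `skewVHAt β ρ X 0 = 0`. -/
theorem skewVHAt_zero_right (ρ : Fin d → ℤ) (X : Form1 d A) (L : ℕ) (μ : Fin d) (y : Fin d → ℤ) :
    skewVHAt β ρ X 0 L μ y = 0 := by
  have h := skewVHAt_add_right β ρ X 0 0 L μ y
  rw [add_zero] at h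
  exact left_eq_add.mp h

/-- [folklore] `skewVHAt β ρ` respects finite sums in the second form. -/
theorem skewVHAt_sum_right {ι : Type*} (s : Finset ι) (ρ : Fin d → ℤ) (X : Form1 d A) (X' : ι → Form1 d A) (L : ℕ)
    (μ : Fin d) (y : Fin d → ℤ) :
    skewVHAt β ρ X (∑ i ∈ s, X' i) L μ y = ∑ i ∈ s, skewVHAt β ρ X (X' i) L μ y := by
  classical
  refine Finset.induction_on s ?_ ?_
  · simp [skewVHAt_zero_right]
  · intro i s hi ih
    rw [Finset.sum_insert hi, Finset.sum_insert hi, skewVHAt_add_right, ih]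

/-! ## §3 The four exact second-order Ward identities, rooted -/

/-- [folklore] **THE ROOTED SECOND-ORDER WARD IDENTITY, W-Hessian type, exact form in the FIRST slot:**
`skewHessAt β ρ (grad λ) B = Z (midF β λ B) − β (λ(r) + λ(r + L·e_μ)) (Z B)`, `r = L·y + ρ`. -/
theorem skewHessAt_grad_left (ρ : Fin d → ℤ) (lam : (Fin d → ℤ) → A) (B : Form1 d A) (L : ℕ) (μ : Fin d)
    (y : Fin d → ℤ) :
    skewHessAt β ρ (grad lam) B L μ y
      = linAvgAt ρ (midF β lam B) L μ y
        - β (lam ((L : ℤ) • y + ρ) + lam ((L : ℤ) • y + ρ + (L : ℤ) • unitVec μ)) (linAvgAt ρ B L μ y) := by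
  have hcard : (box d L).card = L ^ d := by simp [AffineAveraging.box, Fintype.card_piFinset]
  have hβsum : ∀ (c : A) (g : (Fin d → ℕ) → A),
      ∑ b ∈ box d L, β c (g b) = β c (∑ b ∈ box d L, g b) := fun c g => (map_sum (β c) g _).symm
  simp only [skewHessAt, skew_loopCAt_grad, skew_segUp_grad, Finset.sum_sub_distrib, Finset.sum_add_distrib, hβsum,
    sum_box_loopCAt_sum, linAvgAt_grad, hcard, segUp_sum_grad, map_add, map_sub, map_zsmul, AddMonoidHom.add_apply,
    AddMonoidHom.sub_apply, AddMonoidHom.zsmul_apply, smul_add, smul_sub, ← natCast_zsmul, Nat.cast_pow]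
  abel

/-- [folklore] **… W-Hessian type, exact form in the SECOND slot** (by slot exchange). -/
theorem skewHessAt_grad_right (ρ : Fin d → ℤ) (X : Form1 d A) (lam : (Fin d → ℤ) → A) (L : ℕ) (μ : Fin d)
    (y : Fin d → ℤ) :
    skewHessAt β ρ X (grad lam) L μ y
      = -(linAvgAt ρ (midF β.flip lam X) L μ y
          - β.flip (lam ((L : ℤ) • y + ρ) + lam ((L : ℤ) • y + ρ + (L : ℤ) • unitVec μ)) (linAvgAt ρ X L μ y)) := by
  rw [skewHessAt_swap β, skewHessAt_grad_left]

/-- [folklore] **THE ROOTED SECOND-ORDER WARD IDENTITY, product-chart type, exact form in the FIRST slot**: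
`skewVHAt β ρ (grad λ) B = 2L^d • (Z (endF β λ B) − β (λ(r + L·e_μ)) (Z B))` — only the FORWARD endpoints survive and only
the conjugation at the far end `r + L·e_μ` of the coarse bond from the root. -/
theorem skewVHAt_grad_left (ρ : Fin d → ℤ) (lam : (Fin d → ℤ) → A) (B : Form1 d A) (L : ℕ) (μ : Fin d)
    (y : Fin d → ℤ) :
    skewVHAt β ρ (grad lam) B L μ y
      = (2 * (L : ℤ) ^ d) • (linAvgAt ρ (endF β lam B) L μ y
          - β (lam ((L : ℤ) • y + ρ + (L : ℤ) • unitVec μ)) (linAvgAt ρ B L μ y)) := by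
  have hcard : (box d L).card = L ^ d := by simp [AffineAveraging.box, Fintype.card_piFinset]
  have hform : ptF β (grad lam) B = endF β lam B + endF β lam B - midF β lam B := by
    funext κ x
    simp only [ptF_apply, endF_apply, midF_apply, grad, Pi.add_apply, Pi.sub_apply, map_add, map_sub,
      AddMonoidHom.add_apply, AddMonoidHom.sub_apply]
    abel
  rw [skewVHAt, skewHessAt_grad_left, hform, linAvgAt_sub, linAvgAt_addForm, linAvgAt_grad, hcard]
  simp only [map_add, map_sub, map_zsmul, AddMonoidHom.add_apply, AddMonoidHom.sub_apply, AddMonoidHom.zsmul_apply,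
    smul_add, smul_sub, ← natCast_zsmul, Nat.cast_pow, mul_smul, two_zsmul]
  abel

/-- [folklore] **THE ROOTED SECOND-ORDER WARD IDENTITY, product-chart type, exact form in the SECOND slot**:
`skewVHAt β ρ X (grad λ) = 2L^d • (β (Z X) (λ(r)) − Z (iniF β X λ))` — only the INITIAL endpoints survive and only the
conjugation AT THE ROOT `r = L·y + ρ`. -/
theorem skewVHAt_grad_right (ρ : Fin d → ℤ) (X : Form1 d A) (lam : (Fin d → ℤ) → A) (L : ℕ) (μ : Fin d)
    (y : Fin d → ℤ) :
    skewVHAt β ρ X (grad lam) L μ y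
      = (2 * (L : ℤ) ^ d) • (β (linAvgAt ρ X L μ y) (lam ((L : ℤ) • y + ρ)) - linAvgAt ρ (iniF β X lam) L μ y) := by
  have hcard : (box d L).card = L ^ d := by simp [AffineAveraging.box, Fintype.card_piFinset]
  have hform : ptF β X (grad lam) = midF β.flip lam X - (iniF β X lam + iniF β X lam) := by
    funext κ x
    simp only [ptF_apply, iniF_apply, midF_apply, grad, Pi.add_apply, Pi.sub_apply, map_add, map_sub,
      AddMonoidHom.add_apply, AddMonoidHom.flip_apply]
    abel
  rw [skewVHAt, skewHessAt_grad_right, hform, linAvgAt_sub, linAvgAt_addForm, linAvgAt_grad, hcard]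
  simp only [map_add, map_sub, map_zsmul, AddMonoidHom.add_apply, AddMonoidHom.flip_apply, smul_add, smul_sub,
    neg_sub, ← natCast_zsmul, Nat.cast_pow, mul_smul, two_zsmul]
  abel

/-! ## §4 The `ρ = 0` bridges to node 8 -/

/-- [folklore] `skewHessAt β 0 = skewHess β` (node 8). -/
@[simp] theorem skewHessAt_zero (X X' : Form1 d A) (L : ℕ) (μ : Fin d) (y : Fin d → ℤ) :
    skewHessAt β 0 X X' L μ y = skewHess β X X' L μ y := by
  simp only [skewHessAt, skewHess, loopCAt_zero, linAvgAt_zero, add_zero]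

/-- [folklore] `skewVHAt β 0 = skewVH β` (node 8). -/
@[simp] theorem skewVHAt_zero (X X' : Form1 d A) (L : ℕ) (μ : Fin d) (y : Fin d → ℤ) :
    skewVHAt β 0 X X' L μ y = skewVH β X X' L μ y := by
  simp only [skewVHAt, skewVH, skewHessAt_zero, linAvgAt_zero]

end Functional

/-! ## §4b Bridges to node 7aρ's integer kernels (`β = (·*·)` on `ℤ`) -/

section Kernel

variable {d : ℕ}

/-- [folklore] BRIDGE: `hessCountAt ρ f f′ = skewHessAt (·*·) ρ δ_f δ_{f′}`. -/
theorem hessCountAt_eq_skewHessAt (ρ : Fin d → ℤ) (L : ℕ) (μ : Fin d) (y : Fin d → ℤ) (f f' : Bond d) :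
    hessCountAt ρ L μ y f f' = skewHessAt mulZ ρ (δ1 f) (δ1 f') L μ y := by
  simp only [hessCountAt, skewHessAt, linCountAt, cCountAt, wedge_eq_skew, mulZ, AddMonoidHom.mul_apply, smul_eq_mul]
  ring

/-- [folklore] BRIDGE: `vhCountAt ρ f f′ = skewVHAt (·*·) ρ δ_f δ_{f′}`. -/
theorem vhCountAt_eq_skewVHAt (ρ : Fin d → ℤ) (L : ℕ) (μ : Fin d) (y : Fin d → ℤ) (f f' : Bond d) :
    vhCountAt ρ L μ y f f' = skewVHAt mulZ ρ (δ1 f) (δ1 f') L μ y := by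
  have hpt : linAvgAt ρ (ptF mulZ (δ1 f) (δ1 f')) L μ y = if f = f' then linCountAt ρ L μ y f else 0 := by
    rw [ptF_mulZ_δ1]
    split_ifs
    · rfl
    · exact linAvgAt_zeroForm ρ L μ y
  simp only [vhCountAt, skewVHAt, hessCountAt_eq_skewHessAt, hpt, linCountAt, AddMonoidHom.mul_apply, smul_eq_mul]

end Kernel

end Summit.QuantumFields.BalabanUV.Beta.AveragingWardRooted
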